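import Mathlib
import Literature.Algebra.Polynomial.NewtonPolytope
import Literature.Barriers.PneNP.TSPExtensionComplexity
import Literature.Barriers.PneNP.TSPExtensionComplexityFaces
import Literature.Computability.AlgebraicComplexity.CircuitDepth
import Literature.Computability.AlgebraicComplexity.ValiantClasses
import Literature.Computability.AlgebraicComplexity.StandardFamilies
import Literature.Computability.AlgebraicComplexity.PermanentCompleteness
import Literature.Computability.AlgebraicComplexity.PermanentUniversality
import Literature.Computability.AlgebraicComplexity.MonotoneNewtonPolytopeXC
import Literature.Computability.AlgebraicComplexity.MonotoneNewtonPolytopeXCProofs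
import HarnessLib

/-!
# Grochow 2017: monotone projections and Newton polytopes — a monotone circuit of size `s` and
# degree `d` has a Newton polytope of extension complexity `2^{O((log s + log d)²)}`

Topic `Literature/Computability/AlgebraicComplexity` (sibling of the Hrubeš–Yehudayoff file
`MonotoneNewtonPolytopeXC(Proofs)`: monotone FORMULA of size `s` ⇒ `xc(Newt f) ≤ O(s)`, PROVED there as
`HrubesYehudayoff.theorem35_holds`).  Source: J. A. Grochow, *Monotone projection lower bounds from extended
formulation lower bounds*, Theory of Computing 13 (2017), art. 18, 1–15 = arXiv:1510.08417 [Grochow2017]; held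
text `paper:arxiv-1510.08417`, read this session (pages p0005–p0008).  VERBATIM:

* Def. 2.1 (p0005 L10): "The Newton polytope of a polynomial `f(x_1, …, x_n)`, denoted `New(f)`, is the convex
  hull in `ℝⁿ` of the exponent vectors of all monomials appearing in `f` with non-zero coefficient."  (p0005
  L15:) "For a polytope `P`, let `c(P)` denote the “complexity” of `P`, as measured by the minimal number of
  linear inequalities needed to define `P` … A polytope `Q ⊆ ℝ^m` is an extension of `P ⊆ ℝⁿ` if there is an
  affine linear map `ℓ : ℝ^m → ℝⁿ` such that `ℓ(Q) = P`. The extension complexity of `P`, denoted `xc(P)`, is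
  the minimum complexity of any extension of `P`."  (p0005 L5:) "a monotone projection is a projection in which
  all constants appearing in the projection are non-negative."
* **Lemma 3.1** (Main Lemma, p0006 L3–4): "Let `R` be a totally ordered semi-ring, and let `f(x_1, …, x_n)` and
  `g(y_1, …, y_m)` be polynomials over `R` with non-negative coefficients. If `f` is a monotone projection of
  `g`, then some face of `New(g)` is an extension of `New(f)`. In particular, `xc(New(f)) ≤ c(New(g))`."
  Proof (p0006 L7–8): with `ker(π) = {y_i | π(y_i) = 0}`, `K = {e_i = 0 ∀ y_i ∈ ker(π)}`,
  `P = New(g) ∩ K` "is a face of `New(g)`" and "is exactly the convex hull of the exponent vectors of monomials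
  in `g` that are disjoint from `ker(π)`"; `π` "induces a linear map `ℓ_π` from `K` to `ℝⁿ`" and
  "`New(f) = ℓ_π(P)`".
* **Proposition 4.5** (p0007 L39–40): "Any polynomial computable by a monotone formula of size `s` is a
  monotone projection of `perm_{s+1}`." Proof: "The proof of the universality of the permanent given in
  [burgisserBook] works mutatis mutandis in the monotone setting."
* **Corollary 4.6** (p0007 L48): "Over any totally ordered semi-ring, any monotone formula computing the
  Hamiltonian Cycle polynomial, the perfect matching polynomial, or the `q`-th cut polynomial has size at least
  `2^{Ω(n)}`. Consequently, any monotone circuit computing these polynomials has size at least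
  `2^{Ω(√n)}`."  Proof (p0008 L2): "The second part follows from the fact that monotone circuits of size `s`
  can be balanced to have size `poly(s)` and depth `O(log² s)` (the proof in [VSBR] works mutatis mutandis in
  the monotone setting), which can then be converted to monotone formulas of size `s^{O(log s)} = 2^{O(log² s)}`
  by the usual conversion from bounded fan-in circuits to formulas."

## Rendering (tree vocabulary only; no new notion)
MONOTONE = over the semiring `ℝ≥0` (the tree's convention: `complexity f` for `f : MvPolynomial σ ℝ≥0` IS the
monotone fan-in-two circuit complexity, `ArithCircuit.lean`; a Valiant projection `IsProjection f g`
(`ValiantClasses.lean`) over `ℝ≥0` IS a monotone projection, its constants being `≥ 0` perforce).  Newton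
polytope = `Literature.Algebra.Polynomial.NewtonPolytope.newtonPolytope` of the real lift `map NNReal.toRealHom f`
(as in the Hrubeš–Yehudayoff file); "`xc(P) ≤ r`" = `Literature.Barriers.PneNP.HasEFOfSize P r` (slack form,
`TSPExtensionComplexity.lean`); formulas for Prop. 4.5 / Cor. 4.6 = the expressions `ArithExpr ℝ≥0 σ` of the
tree's permanent-universality file (`PermanentCompleteness.lean`, size `E(φ)` = number of operations), fan-in-two
formulas for the composite = `ArithCircuit.IsFormula` (`CircuitDepth.lean`, the HY21 file's choice).
`TODO(general form)`: an arbitrary totally ordered semiring `R` in place of `ℝ≥0`.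

## What is typed (named facts `def … : Prop`, D-0014) and what is proved
* `Grochow.lemma_3_1` — Lemma 3.1 in the STRUCTURAL form of its printed proof: for a substitution
  `π : σ → τ ⊕ ℝ≥0` (variable or non-negative constant) and `f = g ∘ π`,
  `New(f) = ℓ_π (New(g) ∩ {e | e_i = 0 for π i = 0})` with `(ℓ_π e)_j = Σ_{π i = x_j} e_i`.  Stated here as a
  named fact and PROVED in the sibling `GrochowMonotoneCircuitQuasiPolyEFProofs.lean` (`Grochow.lemma_3_1_holds`,
  which imports this file), following the printed proof claim by claim.
* `HasEFOfSize.image_linear` — PROVED: linear images of polytopes in the non-negative orthant cost `≤ |ι|` extra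
  slack variables (generalises the tree's `HasEFOfSize.image_comp`).
* `Grochow.hasEFOfSize_of_lemma_3_1` — PROVED from `lemma_3_1`: the "in particular" of Lemma 3.1 in slack-form
  currency, `HasEFOfSize (New g) r → HasEFOfSize (New f) (|σ| + r)` (the `+|σ|` is the slack-form encoding cost of
  moving the variables of `g` among the sign-constrained extra variables, cf. the module docstring of
  `TSPExtensionComplexityFaces`; printed: `xc(New f) ≤ c(New g)`).
* `Grochow.prop_4_5` — Prop. 4.5, with the index the CITED PROOF delivers: the printed "`perm_{s+1}`"
  comes with no size convention; Bürgisser's construction that Grochow invokes "mutatis mutandis" is in the tree for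
  fields as `BCS1997_thm_21_27_holds` (expression of size `E(φ)` ⇒ `per` of a `(2E(φ)+2)`-matrix), so we state
  `∃ N ≤ 2·E(φ)+2` with `IsProjection φ.eval (perPoly (Fin N) ℝ≥0)` — weaker than print only in the index
  (`TODO(sharper index)`: `N = s + 1` under Grochow's size convention) — and PROVED (`prop_4_5_holds`): the
  tree's `PermanentUniversality.lean` carries Bürgisser's construction over every commutative semiring.
* `Grochow.monotoneCircuitQuasiPolyEF` — the COMPOSITE the `ValiantsHypothesis` line `next_rung_dual`
  (stmt-21181 / K1) calls P1′, in the Hrubeš–Yehudayoff `theorem35` shape and degree-qualified: size `≤ s`,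
  degree `≤ d` ⇒ `HasEFOfSize (New f) (2^{C (log₂ s + log₂ d + 1)²})`.  Grochow obtains such a bound in the
  proof of Cor. 4.6 by balancing ("[VSBR] works mutatis mutandis in the monotone setting", applied there only to
  polynomials of degree `≤ n ≤ s`; without a degree bound that sentence fails: `x^{2^s}`) ⇒ formula of size
  `2^{O(log² s)}` ⇒ Prop. 4.5 ⇒ Lemma 3.1 ⇒ a face of a cycle-cover polytope.  NOT a numbered statement of
  [Grochow2017].  Typed as a named fact and PROVED CONDITIONALLY by `monotoneCircuitQuasiPolyEF_of_circuitXC`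
  from the LINEAR circuit bound "monotone fan-in-two circuit of size `≤ s` ⇒ `HasEFOfSize (New f) (3 s)`"
  (the statement the tree's `MonotoneCircuitNewtonPolytopeXC.lean :: MonotoneCircuitEF.theorem35_circuit` is to
  carry, spelled here verbatim as the hypothesis `hXC`; once it lands, `monotoneCircuitQuasiPolyEF_holds` is the
  one-line application, in the Proofs sibling).  HONEST FLAG for the consumer: the degree-FREE quasi-polynomial
  sentence is not in PRINT; the linear circuit bound, once landed as a theorem, supersedes both.
* NOT typed (val-lit desk RULING #250 (c), no consumer): Cor. 4.6 itself (the `2^{Ω(n)}` / `2^{Ω(√n)}` lower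
  bounds for `HC_n`, `PM_n`, `Cut^q`, which rest on Rothvoß's matching lower bound) and the monotone-VSBR
  balancing step as stand-alone named facts.  (Both were in the first landing of this file, p609942, as
  `Grochow.cor_4_6` / `Grochow.monotoneVSBR` with the proved `monotoneCircuitQuasiPolyEF_of_monotoneVSBR`; they
  were withdrawn unreferenced in the fix-up resubmission — restate them from the quotes above if a consumer
  ever names them.)

Honest framing: typed literature for the extension-complexity programme on `NNDivisionHard`; nothing here bears on
`VP ≠ VNP` (NOT proved), and no summit statement is proved by this file.
-/

noncomputable section

namespace Literature.Computability.AlgebraicComplexity.Grochow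

open scoped NNReal
open Literature.Algebra.Polynomial.NewtonPolytope Literature.Barriers.PneNP Matrix

/-! ## Lemma 3.1 (Main Lemma) -/

/-- **Grochow 2017, Lemma 3.1 (Main Lemma)**, structural form of the printed proof.  A monotone (simple)
projection over `ℝ≥0` is a substitution `π : σ → τ ⊕ ℝ≥0` of each variable `y_i` of `g` by a variable `x_{π i}`
or by a non-negative constant; `f = g ∘ π` (`MvPolynomial.aeval`).  With `ker π = {i | π i = 0}` and the linear
map `(ℓ_π e)_j = Σ_{i : π i = x_j} e_i` induced by `π` on exponent vectors: "`P = New(g) ∩ K` is a face of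
`New(g)` … `New(f) = ℓ_π(P)`" — some face of `New(g)` is an extension of `New(f)`.  (Faithful special case
`R = ℝ≥0` of "any totally ordered semi-ring"; `TODO(general form)`.)
[cite: Grochow2017, Lemma 3.1 (arXiv:1510.08417 p. 6; held p0006.txt L3–8)] -/
def lemma_3_1 : Prop :=
  ∀ (σ τ : Type) [Fintype σ] [Fintype τ] [DecidableEq σ] [DecidableEq τ]
    (π : σ → τ ⊕ ℝ≥0) (g : MvPolynomial σ ℝ≥0),
    newtonPolytope (MvPolynomial.map NNReal.toRealHom
        (MvPolynomial.aeval (fun i => Sum.elim MvPolynomial.X MvPolynomial.C (π i)) g)) =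
      (fun e : σ → ℝ => fun j : τ => ∑ i ∈ Finset.univ.filter (fun i => π i = Sum.inl j), e i) ''
        (newtonPolytope (MvPolynomial.map NNReal.toRealHom g) ∩
          {e | ∀ i, π i = Sum.inr 0 → e i = 0})

/-- **Linear images of non-negative polytopes keep small extended formulations** (slack form): if
`P ⊆ ℝ^ι_{≥ 0}` has `HasEFOfSize P r` and `L : ℝ^ι → ℝ^κ` is linear, then `HasEFOfSize (L P) (|ι| + r)` — keep the
old system with its natural variables moved among the sign-constrained extra variables (valid as `P ≥ 0`) and add
the rows `z - L x = 0`.  Generalises `HasEFOfSize.image_comp` (coordinate maps); this is the slack-form reading of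
"a linear projection of [an extension] … is an extension" used in Lemma 3.1 and in FMPTW's Lemma 9.
[cite: FioriniEtAl2015, Lemma 9 (PDF p. 10)] [cite: Grochow2017, Lemma 3.1 (proof, arXiv p. 6)] -/
theorem _root_.Literature.Barriers.PneNP.HasEFOfSize.image_linear {ι : Type} [Fintype ι] {r : ℕ}
    {P : Set (ι → ℝ)} (h : HasEFOfSize P r) (hP : ∀ x ∈ P, ∀ i, 0 ≤ x i) {κ : Type} [Fintype κ]
    (L : (ι → ℝ) →ₗ[ℝ] (κ → ℝ)) : HasEFOfSize (L '' P) (Fintype.card ι + r) := by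
  classical
  obtain ⟨Q, hQ⟩ := h
  let M : Matrix κ ι ℝ := -LinearMap.toMatrix' L
  have hM : ∀ x : ι → ℝ, M *ᵥ x = -L x := by
    intro x
    simp only [M, Matrix.neg_mulVec, LinearMap.toMatrix'_mulVec]
  have h0 := hasEFOfSize_of_system (ι := κ) (fromRows (0 : Matrix (Fin Q.k) κ ℝ) 1)
    (fromRows (fromCols Q.E Q.F) (fromCols M 0)) (Sum.elim Q.g 0)
  rw [Fintype.card_sum, Fintype.card_fin] at h0
  convert h0 using 1
  ext z
  simp only [Set.mem_image, Set.mem_setOf_eq, fromRows_mulVec, zero_mulVec, one_mulVec,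
    fromCols_mulVec]
  constructor
  · rintro ⟨x, hxP, rfl⟩
    obtain ⟨y, hy, hsys⟩ : x ∈ Q.projSet := by rw [hQ]; exact hxP
    refine ⟨Sum.elim x y, ?_, ?_⟩
    · rintro (i | j)
      · exact hP x hxP i
      · exact hy j
    · rw [sumElim_add_sumElim_eq_sumElim_iff]
      refine ⟨?_, ?_⟩
      · simpa using hsys
      · simp only [Sum.elim_comp_inl, hM, add_zero]
        funext k
        simp
  · rintro ⟨w, hw, hsys⟩
    have hw' : w = Sum.elim (w ∘ Sum.inl) (w ∘ Sum.inr) := by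
      funext s; rcases s with i | j <;> rfl
    rw [hw', sumElim_add_sumElim_eq_sumElim_iff] at hsys
    obtain ⟨h1, h2⟩ := hsys
    simp only [Sum.elim_comp_inl, Sum.elim_comp_inr, hM, add_zero, zero_add] at h1 h2
    refine ⟨w ∘ Sum.inl, ?_, ?_⟩
    · rw [← hQ]
      exact ⟨w ∘ Sum.inr, fun j => hw _, h1⟩
    · funext k
      have := congrFun h2 k
      simp only [Pi.add_apply, Pi.neg_apply, Pi.zero_apply] at this
      linarith

/-- Newton polytopes of polynomials over `ℝ≥0` (indeed of any polynomial) lie in the non-negative orthant.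
[cite: Grochow2017, proof of Lemma 3.1 ("all vertices of `New(g)` are non-negative")] -/
theorem newtonPolytope_nonneg {σ : Type} (p : MvPolynomial σ ℝ) :
    ∀ x ∈ newtonPolytope p, ∀ i, 0 ≤ x i := by
  intro x hx i
  have hconv : Convex ℝ {y : σ → ℝ | 0 ≤ y i} := by
    intro a ha b hb s t hs ht _
    simp only [Set.mem_setOf_eq, Pi.add_apply, Pi.smul_apply, smul_eq_mul] at ha hb ⊢
    positivity
  refine (convexHull_min ?_ hconv) hx
  rintro _ ⟨e, _, rfl⟩
  simp [exponentPt_apply]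

/-- **Lemma 3.1, "in particular"** (`xc(New(f)) ≤ c(New(g))`), in the tree's slack-form currency and PROVED from
the structural fact: if `New(g) ⊆ ℝ^σ` has an extended formulation with `r` inequalities then `New(f)`, for
`f = g ∘ π` a monotone projection of `g`, has one with `|σ| + r` (face: `HasEFOfSize.inter_eqs`, no cost; linear
image: `HasEFOfSize.image_linear`, `+|σ|` for the encoding). [cite: Grochow2017, Lemma 3.1 (arXiv p. 6)] -/
theorem hasEFOfSize_of_lemma_3_1 (h31 : lemma_3_1) {σ τ : Type} [Fintype σ] [Fintype τ] [DecidableEq σ]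
    [DecidableEq τ] (π : σ → τ ⊕ ℝ≥0) (g : MvPolynomial σ ℝ≥0) {r : ℕ}
    (hg : HasEFOfSize (newtonPolytope (MvPolynomial.map NNReal.toRealHom g)) r) :
    HasEFOfSize (newtonPolytope (MvPolynomial.map NNReal.toRealHom
      (MvPolynomial.aeval (fun i => Sum.elim MvPolynomial.X MvPolynomial.C (π i)) g)))
      (Fintype.card σ + r) := by
  classical
  rw [h31 σ τ π g]
  -- the face `New(g) ∩ K`
  have hface : HasEFOfSize (newtonPolytope (MvPolynomial.map NNReal.toRealHom g) ∩
      {e : σ → ℝ | ∀ i, π i = Sum.inr 0 → e i = 0}) r := by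
    have h := hg.inter_eqs (T := {i : σ // π i = Sum.inr 0}) (fun t => Pi.single (t.1 : σ) (1 : ℝ))
      (fun _ => 0)
    convert h using 2
    ext e
    simp only [Set.mem_setOf_eq, Subtype.forall]
    refine forall_congr' fun i => forall_congr' fun _ => ?_
    rw [dotProduct_comm, dotProduct_single, mul_one]
  -- the linear map `ℓ_π`
  let L : (σ → ℝ) →ₗ[ℝ] (τ → ℝ) :=
    { toFun := fun e j => ∑ i ∈ Finset.univ.filter (fun i => π i = Sum.inl j), e i
      map_add' := fun e e' => by
        funext j; simp [Finset.sum_add_distrib]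
      map_smul' := fun c e => by
        funext j; simp [Finset.mul_sum] }
  have hL : (fun e : σ → ℝ => fun j : τ => ∑ i ∈ Finset.univ.filter (fun i => π i = Sum.inl j), e i) =
      (L : (σ → ℝ) → (τ → ℝ)) := rfl
  rw [hL]
  refine hface.image_linear ?_ L
  intro x hx i
  exact newtonPolytope_nonneg _ x hx.1 i

/-! ## Proposition 4.5 -/

/-- **Grochow 2017, Proposition 4.5** ("Any polynomial computable by a monotone formula of size `s` is a
monotone projection of `perm_{s+1}`"), over `ℝ≥0`, formulas = the expressions `ArithExpr ℝ≥0 σ` of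
`PermanentCompleteness.lean` (size `E(φ)`), `perm_N = perPoly (Fin N) ℝ≥0`, monotone projection = `IsProjection`
over `ℝ≥0`.  Index: the printed `s + 1` comes without a size convention; the proof cited "mutatis mutandis"
(Bürgisser's universality of the permanent; in the tree for fields: `BCS1997_thm_21_27_holds`) delivers a
`(2E(φ)+2) × (2E(φ)+2)` permanent, which is the index typed (`TODO(sharper index)`).
[cite: Grochow2017, Proposition 4.5 (arXiv p. 7; held p0007.txt L39–44)] -/
def prop_4_5 : Prop :=
  ∀ (σ : Type) [Fintype σ] [DecidableEq σ] (φ : ArithExpr ℝ≥0 σ),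
    ∃ N : ℕ, N ≤ 2 * φ.size + 2 ∧ IsProjection φ.eval (perPoly (Fin N) ℝ≥0)

/-- **Proposition 4.5 — proved** ("the proof of the universality of the permanent given in [burgisserBook]
works mutatis mutandis in the monotone setting"): the tree's formalisation of that proof
(`PermanentUniversality.lean`: `ArithExpr.toMatrix`, `ArithExpr.entryPer_toMatrix`,
`isProjection_entryPer_perPoly`) is written over an arbitrary commutative semiring, so it applies verbatim to
`ℝ≥0`: `val(φ) = per μ(φ)` for the `(2E(φ)+2)`-matrix `μ(φ)` over `ℝ≥0 ∪ {X_i}`, and `per μ(φ)` is the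
(monotone) projection `X_{ij} ↦ μ(φ)_{ij}` of `PER_{2E(φ)+2}`.
[cite: Grochow2017, Proposition 4.5 and its proof (arXiv p. 7)]
[cite: BurgisserClausenShokrollahi1997, Thm. (21.27)] -/
theorem prop_4_5_holds : Literature.Computability.AlgebraicComplexity.Grochow.prop_4_5 :=
  fun _σ _ _ φ =>
    ⟨2 * φ.size + 2, le_rfl, φ.entryPer_toMatrix ▸ isProjection_entryPer_perPoly φ.toMatrix⟩

/-! ## The composite circuit-to-EF bound -/

/-- **The composite circuit-to-EF bound (P1′ of the `next_rung_dual` line, degree-qualified)**: a monotone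
fan-in-two circuit of size `≤ s` for `f` of total degree `≤ d` gives an extended formulation of `New(f)` with at
most `2^{C (log₂ s + log₂ d + 1)²}` inequalities — the bound Grochow's proof of Cor. 4.6 assembles (balance the
circuit à la [VSBR], "mutatis mutandis in the monotone setting", to a formula of size `2^{O((log s + log d)²)}`
⇒ Prop. 4.5 ⇒ monotone projection of a permanent ⇒ Lemma 3.1 ⇒ a face of a cycle-cover (Birkhoff) polytope with
`m²` inequalities).  NOT a numbered statement of [Grochow2017]; the degree-free variant is not in print.  PROVED
below from the linear circuit bound (`monotoneCircuitQuasiPolyEF_of_circuitXC`).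
[cite: Grochow2017, proof of Corollary 4.6 with Lemma 3.1 and Proposition 4.5 (arXiv pp. 6–8)] -/
def monotoneCircuitQuasiPolyEF : Prop :=
  ∃ C : ℕ, ∀ (n s d : ℕ) (f : MvPolynomial (Fin n) ℝ≥0) (P : ArithCircuit ℝ≥0 (Fin n)),
    P.IsFanInTwo → P.Computes f → P.size ≤ s → f.totalDegree ≤ d →
      HasEFOfSize (newtonPolytope (MvPolynomial.map NNReal.toRealHom f))
        (2 ^ (C * (Nat.log 2 s + Nat.log 2 d + 1) ^ 2))

/-- **P1′ from the linear circuit bound.**  If every monotone fan-in-two circuit of size `≤ s` computing `f`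
yields `HasEFOfSize (New f) (3 s)` — the circuit form of Hrubeš–Yehudayoff's Thm. 35, hypothesis `hXC`, spelled
token-for-token as `MonotoneCircuitNewtonPolytopeXC.lean :: MonotoneCircuitEF.theorem35_circuit` states it — then
`monotoneCircuitQuasiPolyEF` holds with `C = 3`, because `3 s ≤ 2^{log₂ s + 3} ≤ 2^{3 (log₂ s + log₂ d + 1)²}`.
[cite: Grochow2017, proof of Corollary 4.6 (arXiv p. 8)] [cite: HrubesYehudayoff2021, Theorem 35] -/
theorem monotoneCircuitQuasiPolyEF_of_circuitXC
    (hXC : ∀ (n s : ℕ) (f : MvPolynomial (Fin n) ℝ≥0) (P : ArithCircuit ℝ≥0 (Fin n)), P.IsFanInTwo →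
      P.Computes f → P.size ≤ s → HasEFOfSize (newtonPolytope (MvPolynomial.map NNReal.toRealHom f)) (3 * s)) :
    monotoneCircuitQuasiPolyEF := by
  refine ⟨3, fun n s d f P hP hc hs _ => (hXC n s f P hP hc hs).of_le ?_⟩
  have hs' : s < 2 ^ (Nat.log 2 s + 1) := Nat.lt_pow_succ_log_self (by norm_num) s
  have h3 : 3 * s ≤ 2 ^ (Nat.log 2 s + 3) := by
    calc 3 * s ≤ 4 * 2 ^ (Nat.log 2 s + 1) := by omega
      _ = 2 ^ (Nat.log 2 s + 3) := by ring
  refine h3.trans (Nat.pow_le_pow_right (by norm_num) ?_)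
  set L := Nat.log 2 s + Nat.log 2 d + 1 with hLdef
  have hL : Nat.log 2 s + 1 ≤ L := by omega
  have hL1 : 1 ≤ L := by omega
  nlinarith

end Literature.Computability.AlgebraicComplexity.Grochow

end
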